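import Summits.CriticalPhenomena.CardyFormulaZ2.Theorems.CardySelfRefinementLagHandOffReduction
import Summits.CriticalPhenomena.CardyFormulaZ2.Theorems.CardySelfRefinementDefs
import Literature.Probability.Percolation.QuadCrossingContinuityEventsDischarge
import Literature.Probability.Percolation.QuadCrossingContinuityOfLemma51
import HarnessLib.Audit

/-!
# Line `mushroom-transfer` — skeleton for crux `CardySelfRefinement.LagHandOff`
(item stmt-CriticalPhenomena-10268, route route-CriticalPhenomena-CardySelfRefinement)

STRATEGIST line (planner-cstrat-stmt-CriticalPhenomena-10268-s1-0, 2026-08-17), registered ALONGSIDE the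
lead's `hitting_tournament.lean` (untouched).  Card: `Lines/mushroom_transfer.md`; idea:
`Ideas/mushroom-continuity.md`.

## What this line changes

The live skeleton is `R1 ∧ R2‴ ⇒ LagHandOff` with both stubs handed back `promote-stub` by five consecutive
lead seats, every hand-back naming ONE conjecture-grade input: control of the exploration interface at ROUGH
wired arcs (KERNEL-c5 §4 "few-contact windows / boundary double visits"; c4 `BoundaryNearMissVanishes`;
c2 (c″)-boundary; c3 (δ)), "CI-true (Beurling), RSW-open".  This line cuts that input out as THREE
CI-FREE KERNEL STUBS with printed blueprints and leaves the two finite XL programmes the leads already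
mapped as conditional stubs:

* `stub_closeEncounter` (K1) — Camia–Newman 2007 Lemma 7.1 / eq. (14) for the bond-`ℤ²` Dobrushin
  interface of a FIXED admissibly discretised Jordan domain: an interface that enters `B(v, ε′)` at an
  interior arc point `v` touches a discrete arc inside `B(v, ε)` (touching = the medial exploration visits an
  edge with an endpoint in `zdArcA ∪ zdArcB`: adjacency, not docking).  Proof blueprint: CN07 pp. 51–55 —
  at the first entrance time, RSW laterals of the two lining colours in the two side sectors squeeze the
  interface onto the arc (their case `v ∈ J′`); for the last-approach configuration (yellow double crossing
  + blue crossing, their Fig. 11 = KERNEL-c5 §4's "chimney") two closed laterals make a MUSHROOM, killed by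
  the CI-free Lemma 7.3 below.
* `stub_noBoundaryPinch` (K2) — the limit form of Camia–Newman Lemma 7.2: a subsequential limit of the
  interface laws a.s. never visits a boundary point twice (= c2's "no boundary double points of the limit
  curve for ROUGH Jordan ∂D", the tournament method's boundary input; = KERNEL-c5's few-contact PENINSULA:
  a macroscopic piece of `𝒪` attached to the wired arc through a window of width `→ 0`).  Blueprint: CN07
  pp. 55–58 — K1 + six arms (K3) + time reversal reduce it to a mushroom with colours swapped (open stem =
  peninsula lining, closed cap = the interface's closed lining over the excursion + RSW closed laterals in
  the fresh pockets), killed by the CI-free Lemma 7.3.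
* `stub_sixArm` (K3) — whole-plane alternating six-arm bound, exponent `2 + ε`, two radii, for critical
  bond-`ℤ²` in the cluster form `FarField.sixArmThreeClustersAt` of this route's Defs file (five-arm `= 2`,
  Kesten–Sidoravicius–Zhang 1998 / Nolin 2008 Thm 24, whose proof is lattice-independent; `+ ε` by
  `ArmEventsReimer.real_armEvent_append_le_mul` and the RSW one-arm bound).  Shared infrastructure with
  `TrivialSectorRate`'s `sixArmDecayAlong` (the `M_k` models at the endpoint ARE bond-`ℤ²`).
* `stub_quadTransfer_of_kernel` (K4) — R1 (`HittingTournament.stub_quadTransfer`, verbatim) from K1–K3: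
  the E-blind, similarity-equivariant Borel decoder along every quad-convergent positive mesh sequence.
  With the kernel discharged this is the finite programme of the lead's method map (c2: (a″) general-position
  two-inclusion dictionary + Schoenflies square model `exists_isSquareModel`, (c″) no-seal = K2 ∧ K3, (e″)
  assembly by the landed tournament rigidity p79243 / Lusin–Souslin p114120 / a.e.-parameter cuts p126717,
  p126899).  The decoder's OWN near-miss (c4 §2) is per-quad: `{Q⁻ crossed} ∖ {Q⁺ crossed}`, i.e. literally
  `Quad.continuity_of_lemma_5_1` — no location-uniform docking statement is consumed.
* `stub_limitMarkov_of_kernel` (K5) — R2′ (`stub_limitMarkov`, verbatim: the family pinned by a quad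
  sublimit is domain Markov) from R1 and K1–K3: the lead c3 plan (i) inner Jordan approximation of slit
  domains, (ii) uniform-in-mesh coupling lemma whose failure modes are (α)(β) six-arm = K3, (γ) RSW,
  (δ) near-touches of `∂D`-parts = K1/K2 applied to LATER PORTIONS OF THE SAME INTERFACE (discrete domain
  Markov is exact, so the future of a slit domain is a tail of `γ` in the fixed `D`), (iii) Cauchy ⇒ kernel;
  then `stub_limitMarkov_of_core` p122633 / KernelGluing p122089.

## The CI-free Camia–Newman Lemma 7.3 (why K1/K2 are not conjecture-grade)

CN07 use conformal invariance in §7 ONLY through Lemma 7.3 (`μ(C₁) = μ(C₂) = μ(C₃)`: crossing in the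
closure = open-air crossing, for Jordan `D′` with four marked points; proved there from Cardy + continuity of
Cardy in the domain) and eq. (24) (a one-arm smallness at two points, RSW).  The EQUALITY in 7.3 is
Schramm–Smirnov's crossing continuity for the quad `Q(D′)` between a pulled-in `Q′ < Q` and a pushed-out
`Q″ > Q` — a THEOREM of the tree for arbitrary quads: `noMushroom_quad` below is a term over
`QuadCrossing.Quad.continuity_of_lemma_5_1` and `QuadCrossing.SchrammSmirnov2011_lemma_5_1_holds`
(trust base = kernel; Schoenflies chart `Quad.exists_homeomorph_extend`).  The mushroom of CN07 Lemma 7.4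
at `v ∈ z₁z₂ ⊂ ∂D` (segment of diameter `≤ ε/10`, `D′ =` that piece of `∂D` + an arc of `∂B(v₀, ε/2)`,
CN07 Fig. 10) is contained in `{Q′(D′) crossed by the stem} ∧ {Q″(D′) not crossed}` (the cap, anchored on
`∂D` at distance `∈ (ε/8, ε/3)` on both sides of `v`, blocks every open-air crossing), so its probability is
`≤ η` for `δ < δ₀(η, D′_j)`; the union over LOCATIONS is over the finitely many `D′_j` of an `ε/10`-net of
`∂D` minus the marked points — never over `ρ^{-d}` boxes at the vanishing approach scale, which is where
every arm-exponent attempt of seats c2–c5 broke.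

## Disproof.lean obligations honoured (cdisprove g1–g4; Negative/* landed)
Both antecedents are used exactly once, for covariance, inside the landed glue
`lagHandOff_of_quadTransfer_limitMarkov` (p127346) (`stub_covarianceFromDictionary` p71518): this line's
`LagHandOff_of` is that glue applied to K4/K5.  Both guards (`ZdDiscretisationFamily`, `0 < δs n`) are
hypotheses of K1, K2, K4, K5.  NC1 `Negative.interfaces_merge_of_handsOff'` applies to K4's conclusion
(E-blindness asserted openly, as in the live line).  No `stopAt`-continuity step (Negative/StopAtDiscontinuity)
is used: every passage is a lattice identity + a Schramm–Smirnov continuity set.  No landed Negative lemma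
concerns boundary-approach events; no `<stub>_false` exists for any statement below (K1–K3 are new).
-/

noncomputable section

open MeasureTheory Filter Set Topology
open scoped unitInterval BoundedContinuousFunction ENNReal
open Literature.Probability.Percolation Literature.Probability.LatticeModels
open Literature.Probability.RandomPlanarGeometry Literature.Probability.Percolation.QuadCrossing
open Summit.CriticalPhenomena.CardyFormulaZ2.Theses.CardySelfRefinement

namespace Summit.CriticalPhenomena.CardyFormulaZ2.Cruxes.LagHandOff.MushroomTransfer

open Summit.CriticalPhenomena.CardyFormulaZ2.Cruxes.LagHandOff.HittingTournament
open Summit.CriticalPhenomena.CardyFormulaZ2.Cruxes.LagHandOff.CrosscutDictionary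

/-! ## The tree theorem this line rests on (NOT a stub) -/

/-- **CI-free Camia–Newman Lemma 7.3 at one quad** = Schramm–Smirnov (5.1) for critical bond-`ℤ²`
(tree: `Quad.continuity_of_lemma_5_1` ∘ `SchrammSmirnov2011_lemma_5_1_holds`): for every quad `Q₀` of
the plane there are a strictly easier `Q′` and a strictly harder `Q″` such that "`Q′` crossed but `Q″` not"
has probability `≤ ε` at every small mesh.  Closure-crossings of `Q₀` are crossings of `Q′`; crossings of
`Q″` are open-air crossings of `Q₀`. -/
theorem noMushroom_quad (Q₀ : Quad (Set.univ : Set ℂ)) (ε : ℝ≥0∞) (hε : 0 < ε) :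
    ∃ Q' Q'' : Quad (Set.univ : Set ℂ), Quad.StrictlyDominated Q' Q₀ ∧ Quad.StrictlyDominated Q₀ Q'' ∧
      ∃ δ₀ : ℝ, 0 < δ₀ ∧ ∀ δ : ℝ, 0 < δ → δ < δ₀ →
        bondPercolation (zdGraph 2) half
          {ω | (∃ K, Q'.IsCrossing K ∧ K ⊆ openEdgeUnion δ ω) ∧
            ¬ ∃ K, Q''.IsCrossing K ∧ K ⊆ openEdgeUnion δ ω} ≤ ε :=
  Quad.continuity_of_lemma_5_1 SchrammSmirnov2011_lemma_5_1_holds Q₀ ε hε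

/-! ## Stubs (five registered open lemmas of the line) -/

/-- **K1 `stub_closeEncounter` — Camia–Newman Lemma 7.1 / (14) for the bond-`ℤ²` Dobrushin interface of a
fixed admissibly discretised Jordan domain (CI-free: RSW squeeze + mushroom + `noMushroom_quad`).**
For every `ε, η > 0` there is `ε′ > 0` such that at every small mesh, with probability `> 1 − η`, there is NO
boundary point `v` at distance `≥ ε` from both marked points such that the medial exploration enters
`B(v, ε′)` but visits no edge with an endpoint on a discrete arc inside `B(v, ε)`. -/
theorem stub_closeEncounter :
    ∀ (D : DobrushinDomain) (E : ℝ → DiscreteDobrushin), ZdDiscretisationFamily D E →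
      ∀ ε : ℝ, 0 < ε → ∀ η : ℝ, 0 < η → ∃ ε' : ℝ, 0 < ε' ∧ ∀ᶠ δ in 𝓝[>] (0 : ℝ),
        (bondPercolation (zdGraph 2) half).real
          {ω | ∃ v ∈ frontier D.carrier, ε ≤ dist v (D.pt 0) ∧ ε ≤ dist v (D.pt 1) ∧
            (∃ e ∈ medialExploration (E δ) ω, medialPoint δ e ∈ Metric.ball v ε') ∧
            ¬ ∃ e ∈ medialExploration (E δ) ω, medialPoint δ e ∈ Metric.ball v ε ∧
                ∃ x ∈ e, x ∈ (E δ).zdArcA ∪ (E δ).zdArcB} < η := by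
  sorry

/-- **K2 `stub_noBoundaryPinch` — the limit form of Camia–Newman Lemma 7.2 (CI-free: K1 + K3 + time
reversal + mushroom + `noMushroom_quad`).**  Every subsequential weak limit `ν` of the interface laws of an
admissible discretisation family of a Jordan domain, along a positive null mesh sequence, gives probability
zero to curves that visit a boundary point twice (`c s = c u ∈ ∂D`, `s < t < u` ⇒ `c t = c s`): no boundary
pinch, no few-contact peninsula, no boundary double point at ROUGH `∂D`. -/
theorem stub_noBoundaryPinch :
    ∀ (D : DobrushinDomain) (E : ℝ → DiscreteDobrushin), ZdDiscretisationFamily D E →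
      ∀ (δs : ℕ → ℝ), (∀ n, 0 < δs n) → Tendsto δs atTop (𝓝 0) →
      ∀ ν : ProbabilityMeasure (CurveClass ℂ),
        (∀ f : CurveClass ℂ →ᵇ ℝ, Tendsto (fun n => ∫ ω, f (bondInterfaceIn D (E (δs n)) ω)
            ∂(bondPercolation (zdGraph 2) half)) atTop (𝓝 (∫ γ, f γ ∂(ν : Measure (CurveClass ℂ))))) →
        ∀ᵐ γ ∂(ν : Measure (CurveClass ℂ)), ∀ c : Curve ℂ, CurveClass.mk c = γ →
          ∀ s t u : I, s < t → t < u → c s ∈ frontier D.carrier → c u = c s → c t = c s := by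
  sorry

/-- **K3 `stub_sixArm` — whole-plane alternating six-arm bound with exponent `2 + ε` (two radii) for
critical bond-`ℤ²`, cluster form** (five-arm `= 2`: Kesten–Sidoravicius–Zhang 1998, Nolin 2008 Thm 24;
`+ ε`: Reimer, tree `ArmEventsReimer.real_armEvent_append_le_mul` + RSW one-arm).  Shared with
`TrivialSectorRate`'s six-arm infrastructure. -/
theorem stub_sixArm :
    ∃ ε : ℝ, 0 < ε ∧ ∃ C : ℝ, ∀ (c : Site 2) (m n : ℕ), 1 ≤ m → m ≤ n →
      (bondPercolation (zdGraph 2) half).real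
        (Summit.CriticalPhenomena.CardyFormulaZ2.Theorems.CardySelfRefinement.FarField.sixArmThreeClustersAt
          c m n) ≤ C * ((m : ℝ) / n) ^ (2 + ε) := by
  sorry

/-- **K4 `stub_quadTransfer_of_kernel` — R1 (`HittingTournament.stub_quadTransfer`, verbatim) from the
kernel package K1–K3**: the E-blind, exactly similarity-equivariant Borel quad → interface decoder on ALL
Jordan domains along every quad-convergent positive mesh sequence (GPS13 Question 10, joint form, for `ℤ²`
sublimits).  XL but finite: c2's (a″) general-position two-inclusion dictionary + Schoenflies square model,
(c″) = K2 ∧ K3, (e″) assembly over the landed tournament rigidity / Lusin–Souslin / a.e.-parameter cuts;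
boundary near-misses of the decoder's own reference quads are `noMushroom_quad` instances. -/
theorem stub_quadTransfer_of_kernel :
    (∀ (D : DobrushinDomain) (E : ℝ → DiscreteDobrushin), ZdDiscretisationFamily D E →
        ∀ ε : ℝ, 0 < ε → ∀ η : ℝ, 0 < η → ∃ ε' : ℝ, 0 < ε' ∧ ∀ᶠ δ in 𝓝[>] (0 : ℝ),
          (bondPercolation (zdGraph 2) half).real
            {ω | ∃ v ∈ frontier D.carrier, ε ≤ dist v (D.pt 0) ∧ ε ≤ dist v (D.pt 1) ∧
              (∃ e ∈ medialExploration (E δ) ω, medialPoint δ e ∈ Metric.ball v ε') ∧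
              ¬ ∃ e ∈ medialExploration (E δ) ω, medialPoint δ e ∈ Metric.ball v ε ∧
                  ∃ x ∈ e, x ∈ (E δ).zdArcA ∪ (E δ).zdArcB} < η) →
    (∀ (D : DobrushinDomain) (E : ℝ → DiscreteDobrushin), ZdDiscretisationFamily D E →
        ∀ (δs : ℕ → ℝ), (∀ n, 0 < δs n) → Tendsto δs atTop (𝓝 0) →
        ∀ ν : ProbabilityMeasure (CurveClass ℂ),
          (∀ f : CurveClass ℂ →ᵇ ℝ, Tendsto (fun n => ∫ ω, f (bondInterfaceIn D (E (δs n)) ω)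
              ∂(bondPercolation (zdGraph 2) half)) atTop (𝓝 (∫ γ, f γ ∂(ν : Measure (CurveClass ℂ))))) →
          ∀ᵐ γ ∂(ν : Measure (CurveClass ℂ)), ∀ c : Curve ℂ, CurveClass.mk c = γ →
            ∀ s t u : I, s < t → t < u → c s ∈ frontier D.carrier → c u = c s → c t = c s) →
    (∃ ε : ℝ, 0 < ε ∧ ∃ C : ℝ, ∀ (c : Site 2) (m n : ℕ), 1 ≤ m → m ≤ n →
        (bondPercolation (zdGraph 2) half).real
          (Summit.CriticalPhenomena.CardyFormulaZ2.Theorems.CardySelfRefinement.FarField.sixArmThreeClustersAt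
            c m n) ≤ C * ((m : ℝ) / n) ^ (2 + ε)) →
    ∃ Ψ : DobrushinDomain → QuadConfig (Set.univ : Set ℂ) → CurveClass ℂ,
      (∀ D : DobrushinDomain, Measurable (Ψ D)) ∧
      (∀ (D : DobrushinDomain) (c : ℂ) (hc : c ≠ 0) (w : ℂ) (S : QuadConfig (Set.univ : Set ℂ)),
        Ψ (D.map (similarity c hc w)) (S.mapHomeomorph (similarity c hc w)) =
          (Ψ D S).map (similarity c hc w : C(ℂ, ℂ))) ∧
      (∀ (μ : FiniteMeasure (QuadConfig (Set.univ : Set ℂ))) (δs : ℕ → ℝ), (∀ n, 0 < δs n) →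
        Tendsto δs atTop (𝓝 0) →
        Tendsto (fun n => z2QuadLaw (Set.univ : Set ℂ) (δs n)) atTop (𝓝 μ) →
        ∀ (D : DobrushinDomain) (E : ℝ → DiscreteDobrushin), ZdDiscretisationFamily D E →
          ∀ f : (QuadConfig (Set.univ : Set ℂ) × CurveClass ℂ) →ᵇ ℝ,
            Tendsto (fun n => ∫ ω, f (z2QuadConfig (Set.univ : Set ℂ) (δs n) ω,
                Literature.Probability.Percolation.bondInterfaceIn D (E (δs n)) ω) ∂(bondPercolation (zdGraph 2) half))
              atTop (𝓝 (∫ S, f (S, Ψ D S) ∂(μ : Measure (QuadConfig (Set.univ : Set ℂ)))))) := by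
  sorry

/-- **K5 `stub_limitMarkov_of_kernel` — R2′ (`stub_limitMarkov`, verbatim: the chordal family pinned by a
quad sublimit is domain Markov) from R1 and the kernel package K1–K3**: lead c3's plan (inner Jordan
approximation of slit domains; uniform-in-mesh coupling lemma with failure modes six-arm = K3, RSW, and
`∂D`-near-touches = K1/K2 applied to tails of the same interface; Cauchy ⇒ one slit kernel), then the landed
`stub_limitMarkov_of_core` (p122633) / kernel gluing (p122089). -/
theorem stub_limitMarkov_of_kernel :
    (∃ Ψ : DobrushinDomain → QuadConfig (Set.univ : Set ℂ) → CurveClass ℂ,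
        (∀ D : DobrushinDomain, Measurable (Ψ D)) ∧
        (∀ (D : DobrushinDomain) (c : ℂ) (hc : c ≠ 0) (w : ℂ) (S : QuadConfig (Set.univ : Set ℂ)),
          Ψ (D.map (similarity c hc w)) (S.mapHomeomorph (similarity c hc w)) =
            (Ψ D S).map (similarity c hc w : C(ℂ, ℂ))) ∧
        (∀ (μ : FiniteMeasure (QuadConfig (Set.univ : Set ℂ))) (δs : ℕ → ℝ), (∀ n, 0 < δs n) →
          Tendsto δs atTop (𝓝 0) →
          Tendsto (fun n => z2QuadLaw (Set.univ : Set ℂ) (δs n)) atTop (𝓝 μ) →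
          ∀ (D : DobrushinDomain) (E : ℝ → DiscreteDobrushin), ZdDiscretisationFamily D E →
            ∀ f : (QuadConfig (Set.univ : Set ℂ) × CurveClass ℂ) →ᵇ ℝ,
              Tendsto (fun n => ∫ ω, f (z2QuadConfig (Set.univ : Set ℂ) (δs n) ω,
                  Literature.Probability.Percolation.bondInterfaceIn D (E (δs n)) ω) ∂(bondPercolation (zdGraph 2) half))
                atTop (𝓝 (∫ S, f (S, Ψ D S) ∂(μ : Measure (QuadConfig (Set.univ : Set ℂ))))))) →
    (∀ (D : DobrushinDomain) (E : ℝ → DiscreteDobrushin), ZdDiscretisationFamily D E →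
        ∀ ε : ℝ, 0 < ε → ∀ η : ℝ, 0 < η → ∃ ε' : ℝ, 0 < ε' ∧ ∀ᶠ δ in 𝓝[>] (0 : ℝ),
          (bondPercolation (zdGraph 2) half).real
            {ω | ∃ v ∈ frontier D.carrier, ε ≤ dist v (D.pt 0) ∧ ε ≤ dist v (D.pt 1) ∧
              (∃ e ∈ medialExploration (E δ) ω, medialPoint δ e ∈ Metric.ball v ε') ∧
              ¬ ∃ e ∈ medialExploration (E δ) ω, medialPoint δ e ∈ Metric.ball v ε ∧
                  ∃ x ∈ e, x ∈ (E δ).zdArcA ∪ (E δ).zdArcB} < η) →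
    (∀ (D : DobrushinDomain) (E : ℝ → DiscreteDobrushin), ZdDiscretisationFamily D E →
        ∀ (δs : ℕ → ℝ), (∀ n, 0 < δs n) → Tendsto δs atTop (𝓝 0) →
        ∀ ν : ProbabilityMeasure (CurveClass ℂ),
          (∀ f : CurveClass ℂ →ᵇ ℝ, Tendsto (fun n => ∫ ω, f (bondInterfaceIn D (E (δs n)) ω)
              ∂(bondPercolation (zdGraph 2) half)) atTop (𝓝 (∫ γ, f γ ∂(ν : Measure (CurveClass ℂ))))) →
          ∀ᵐ γ ∂(ν : Measure (CurveClass ℂ)), ∀ c : Curve ℂ, CurveClass.mk c = γ →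
            ∀ s t u : I, s < t → t < u → c s ∈ frontier D.carrier → c u = c s → c t = c s) →
    (∃ ε : ℝ, 0 < ε ∧ ∃ C : ℝ, ∀ (c : Site 2) (m n : ℕ), 1 ≤ m → m ≤ n →
        (bondPercolation (zdGraph 2) half).real
          (Summit.CriticalPhenomena.CardyFormulaZ2.Theorems.CardySelfRefinement.FarField.sixArmThreeClustersAt
            c m n) ≤ C * ((m : ℝ) / n) ^ (2 + ε)) →
    ∀ μ ∈ subseqQuadLimits (Set.univ : Set ℂ), ∀ P : ChordalFamily,
          (∀ δs : ℕ → ℝ, (∀ n, 0 < δs n) → Tendsto δs atTop (𝓝 0) →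
            Tendsto (fun n => z2QuadLaw (Set.univ : Set ℂ) (δs n)) atTop (𝓝 μ) →
            ∀ (D : DobrushinDomain) (E : ℝ → DiscreteDobrushin), ZdDiscretisationFamily D E →
              ∀ f : CurveClass ℂ →ᵇ ℝ,
                Tendsto (fun n => ∫ ω, f (bondInterfaceIn D (E (δs n)) ω)
                  ∂(bondPercolation (zdGraph 2) half)) atTop (𝓝 (∫ γ, f γ ∂(P D)))) →
          (∀ D : DobrushinDomain, ∃ E : ℝ → DiscreteDobrushin, ZdDiscretisationFamily D E) →
          P.IsDomainMarkov := by
  sorry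

/-! ## Glue (sorry-free): K1–K5 ⇒ `LagHandOff` through the LANDED reduction (p127346) -/

/-- **`LagHandOff` from the five stubs**: K4 gives R1, K5 gives R2′, and the landed
`lagHandOff_of_quadTransfer_limitMarkov` (Theorems/CardySelfRefinementLagHandOffReduction.lean, p127346 —
clause (i) outright, SS11 subsequence, chordality, covariance = the only use of the antecedents, locality /
target independence, discretisability, no-trace) concludes. -/
theorem LagHandOff_of : LagHandOff :=
  lagHandOff_of_quadTransfer_limitMarkov
    (stub_quadTransfer_of_kernel stub_closeEncounter stub_noBoundaryPinch stub_sixArm)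
    (stub_limitMarkov_of_kernel
      (stub_quadTransfer_of_kernel stub_closeEncounter stub_noBoundaryPinch stub_sixArm)
      stub_closeEncounter stub_noBoundaryPinch stub_sixArm)

/-- The crux, by name (type literally the route decl). -/
theorem lagHandOff_proof :
    Summit.CriticalPhenomena.CardyFormulaZ2.Theses.CardySelfRefinement.LagHandOff :=
  LagHandOff_of

end Summit.CriticalPhenomena.CardyFormulaZ2.Cruxes.LagHandOff.MushroomTransfer

end
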